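import Literature.Analysis.InnerProduct.HilbertComplexRolledUp
import HarnessLib

/-!
# `Δ_ev = D*D = T*T ⊕ SS*` and `Δ_odd = DD* = TT* + S*S` for the rolled-up operator of a short Hilbert complex;
# `Ker D* = 𝔥` and `ind_a = dim Ker D − dim Ker D*` (Brüning–Lesch 1992 (2.14), (2.25); Gilkey 1995 §1.5)

Layer `Literature/Analysis/InnerProduct`, namespace `Literature.Analysis.InnerProduct`; sequel BY NAME of
`HilbertComplexRolledUp.lean` (row g33-#8: the rolled-up operator `D = T ⊕ S*` on `WithLp 2 (E × G)` given by the
hypotheses `hdomD`/`hvalD`; `rolledUp_apply`, `dense_rolledUp_domain`, `mem_rolledUp_adjoint_domain_iff`,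
`rolledUp_adjoint_apply` (`D* = T* ⊕ S`), `orthogonal_range_rolledUp_eq_harmonic`, `finrank_pmapKer_rolledUp`),
`ClosedDenselyDefinedHilbertComplex.lean` (`range_adjoint_le_pmapKer_adjoint`: `Im S* ⊆ Ker T*`,
`orthogonal_range_eq_ker_adjoint`) and `HilbertComplexLaplacian.lean` (`re_inner_laplacian_self`). Lane
`lit-hodgefound` (Track 2 foundations library), prover seat `lit-hodgefound-p06` (generation 33), self-proposed row
g33-#9. THEOREMS ONLY (no definition, no instance, no named fact); the Laplacians `T*T` (`hdomA`/`hvalA`),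
`□ = TT* + S*S` (`hdom`/`hval`), `SS*` (`hdomC`/`hvalC`) are hypothesis-parametrised as in all rows of this seat.

## Sources, verbatim

J. Brüning, M. Lesch, *Hilbert complexes*, J. Funct. Anal. 108 (1992), §2 p. 92 (held text
`paper:doi-10-1016-0022-1236-92-90147-b`, p0005): "Hence we can associate with `D` three self-adjoint nonnegative
operators, namely `Δ_ev := D*D`, `Δ_odd := DD*`, `Δ := Δ_ev ⊕ Δ_odd` (2.14a). Note that `D ⊕ D*` is also
self-adjoint and that `Δ = (D ⊕ D*)²`. Yet another family of self-adjoint operators is of interest: we write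
`Δ = ⊕_{i≥0} D_{i−1}D*_{i−1} ⊕ ⊕_{i≥0} D_i*D_i =: ⊕ Δ¹_i ⊕ ⊕ Δ²_i =: Δ¹ ⊕ Δ²` (2.14b) … LEMMA 2.2. We have
`𝓗̂_i = ker Δ ∩ H_i = ker Δ¹ ∩ ker Δ² ∩ H_i`"; p. 96 (p0009): "(2.25) `ind_a(𝒟, D) := ∑ (−1)ⁱ β̂_i = dim ker D −
dim ker D*` … Note that `D` need not be Fredholm for the analytic index to be well defined." P. B. Gilkey (1995),
§1.5 p. 45: "`(d + δ)` is an elliptic operator since `(d + δ)_e^*(d + δ)_e = Δ` … `(d + δ)_e^* = (d + δ)_o` … It is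
clear `index (d + δ)_e = dim N(Δ^e) − dim N(Δ^o) = χ(M)`."

For the short complex `0 → E →T F →S G → 0` with `D = T ⊕ S* : E ⊕ G → F`: `Δ_ev = D*D` is `T*T ⊕ SS*` on `E ⊕ G`
and `Δ_odd = DD*` is `TT* + S*S` on `F` — the content of (2.14a) = (2.14b) degree by degree.

## What is proved

* §1 **`norm_sq_rolledUp_adjoint_apply`** (`‖D*u‖² = ‖T*u‖² + ‖Su‖²`); **`pmapKer_rolledUp_adjoint_eq_harmonic`**
  (`Ker D* = Ker S ∩ Ker T* = 𝔥`); **`finrank_pmapKer_rolledUp_sub_finrank_pmapKer_adjoint`** — (2.25)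
  `dim Ker D − dim Ker D* = dim Ker T − dim 𝔥 + dim Ker S*`.
* §2 `adjoint_apply_mem_adjoint_domain`, `adjoint_apply_adjoint_apply_eq_zero` (`T*S* = 0`),
  `apply_mem_domain_and_apply_apply_eq_zero` (`ST = 0`); **`rolledUp_apply_mem_adjoint_domain_iff`** (`D(D*D) =
  D(T*T) × D(SS*)`) and **`rolledUp_adjoint_rolledUp_apply`** (`D*D(x ⊕ z) = T*Tx ⊕ SS*z`).
* §3 **`rolledUp_adjoint_apply_mem_domain_iff`** (`D(DD*) = D(□)`), **`rolledUp_rolledUp_adjoint_apply`**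
  (`DD*u = □u`), `norm_sq_rolledUp_adjoint_apply_eq_re_inner_laplacian` (`‖D*u‖² = Re(□u, u)`).

## References

* [BruningLesch1992] J. Brüning, M. Lesch, *Hilbert complexes*, J. Funct. Anal. 108 (1992) 88–132, §2 (2.13), (2.14a/b),
  Lemma 2.2, (2.25).
* [Gilkey1995] P. B. Gilkey, *Invariance theory, the heat equation, and the Atiyah–Singer index theorem*, 2nd ed., CRC
  Press (1995), §1.5 p. 45.
* [DemaillyAGBook] J.-P. Demailly, *Complex Analytic and Differential Geometry*, Ch. VIII §1 Thm 1.1–1.2 (through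
  `ClosedDenselyDefinedHilbertComplex.lean`).
-/

noncomputable section

open scoped InnerProductSpace LinearPMap

open Filter Topology

namespace Literature.Analysis.InnerProduct

variable {𝕜 E F G : Type*} [RCLike 𝕜]
variable [NormedAddCommGroup E] [InnerProductSpace 𝕜 E] [CompleteSpace E]
variable [NormedAddCommGroup F] [InnerProductSpace 𝕜 F] [CompleteSpace F]
variable [NormedAddCommGroup G] [InnerProductSpace 𝕜 G] [CompleteSpace G]

variable {T : E →ₗ.[𝕜] F} {S : F →ₗ.[𝕜] G} {D : WithLp 2 (E × G) →ₗ.[𝕜] F}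
  {A : E →ₗ.[𝕜] E} {L : F →ₗ.[𝕜] F} {C : G →ₗ.[𝕜] G}

/-! ### §1 `Ker D* = Ker T* ∩ Ker S = 𝔥`, `‖D*u‖² = ‖T*u‖² + ‖Su‖²`, and `ind_a = dim Ker D − dim Ker D*` -/

/-- **`‖D*u‖² = ‖T*u‖² + ‖Su‖²`** — the Dirichlet form of the complex is the graph form of the rolled-up adjoint.
[cite: BruningLesch1992, §2 (2.13)–(2.14a) (`Δ_odd := DD*`); Gilkey1995, §1.5 p. 45 ("`(d + δ)_e^* = (d + δ)_o`")] -/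
theorem norm_sq_rolledUp_adjoint_apply (hdT : Dense (T.domain : Set E)) (hdS : Dense (S.domain : Set F))
    (hcS : S.IsClosed)
    (hdomD : ∀ v : WithLp 2 (E × G), v ∈ D.domain ↔ v.fst ∈ T.domain ∧ v.snd ∈ S†.domain)
    (hvalD : ∀ (v : D.domain) (h1 : (v : WithLp 2 (E × G)).fst ∈ T.domain)
      (h2 : (v : WithLp 2 (E × G)).snd ∈ S†.domain),
      D v = T ⟨(v : WithLp 2 (E × G)).fst, h1⟩ + S† ⟨(v : WithLp 2 (E × G)).snd, h2⟩)
    (u : D†.domain) (huT : (u : F) ∈ T†.domain) (huS : (u : F) ∈ S.domain) :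
    ‖D† u‖ ^ 2 = ‖T† ⟨u, huT⟩‖ ^ 2 + ‖S ⟨u, huS⟩‖ ^ 2 := by
  rw [rolledUp_adjoint_apply hdT hdS hcS hdomD hvalD u huT huS, WithLp.prod_norm_sq_eq_of_L2]
  rfl

/-- **`Ker D* = Ker S ∩ Ker T* = 𝔥`**: the kernel of the rolled-up adjoint is the harmonic space ("`dim ker D*`" in
`ind_a = dim ker D − dim ker D*`). [cite: BruningLesch1992, §2 Lemma 2.2 ("`𝓗̂_i = ker Δ ∩ H_i`"), (2.25);
Gilkey1995, §1.5 p. 45 ("`index (d + δ)_e = dim N(Δ^e) − dim N(Δ^o)`")] -/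
theorem pmapKer_rolledUp_adjoint_eq_harmonic (hdT : Dense (T.domain : Set E)) (hdS : Dense (S.domain : Set F))
    (hcS : S.IsClosed)
    (hdomD : ∀ v : WithLp 2 (E × G), v ∈ D.domain ↔ v.fst ∈ T.domain ∧ v.snd ∈ S†.domain)
    (hvalD : ∀ (v : D.domain) (h1 : (v : WithLp 2 (E × G)).fst ∈ T.domain)
      (h2 : (v : WithLp 2 (E × G)).snd ∈ S†.domain),
      D v = T ⟨(v : WithLp 2 (E × G)).fst, h1⟩ + S† ⟨(v : WithLp 2 (E × G)).snd, h2⟩) :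
    (LinearMap.ker D†.toFun).map D†.domain.subtype =
      (LinearMap.ker S.toFun).map S.domain.subtype ⊓ (LinearMap.ker T†.toFun).map T†.domain.subtype := by
  rw [← orthogonal_range_eq_ker_adjoint (dense_rolledUp_domain hdT (dense_adjoint_domain_of_isClosed hdS hcS) hdomD),
    orthogonal_range_rolledUp_eq_harmonic hdT hdS hcS hdomD hvalD]

/-- **Brüning–Lesch (2.25) for a short complex: `ind_a = dim Ker D − dim Ker D* = dim Ker T − dim 𝔥 + dim Ker S*`**
(with `Ker D*` in place of `(Im D)^⊥`; finite-dimensional `Ker T`, `Ker S*`). [cite: BruningLesch1992, §2 (2.25)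
("`ind_a(𝒟, D) := ∑ (−1)ⁱ β̂_i = dim ker D − dim ker D*`"); Gilkey1995, §1.5 p. 45] -/
theorem finrank_pmapKer_rolledUp_sub_finrank_pmapKer_adjoint (hdT : Dense (T.domain : Set E))
    (hdS : Dense (S.domain : Set F)) (hcS : S.IsClosed)
    (hST : LinearMap.range T.toFun ≤ (LinearMap.ker S.toFun).map S.domain.subtype)
    (hdomD : ∀ v : WithLp 2 (E × G), v ∈ D.domain ↔ v.fst ∈ T.domain ∧ v.snd ∈ S†.domain)
    (hvalD : ∀ (v : D.domain) (h1 : (v : WithLp 2 (E × G)).fst ∈ T.domain)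
      (h2 : (v : WithLp 2 (E × G)).snd ∈ S†.domain),
      D v = T ⟨(v : WithLp 2 (E × G)).fst, h1⟩ + S† ⟨(v : WithLp 2 (E × G)).snd, h2⟩)
    [FiniteDimensional 𝕜 ((LinearMap.ker T.toFun).map T.domain.subtype)]
    [FiniteDimensional 𝕜 ((LinearMap.ker S†.toFun).map S†.domain.subtype)] :
    (Module.finrank 𝕜 ((LinearMap.ker D.toFun).map D.domain.subtype) : ℤ) -
        Module.finrank 𝕜 ((LinearMap.ker D†.toFun).map D†.domain.subtype) =
      (Module.finrank 𝕜 ((LinearMap.ker T.toFun).map T.domain.subtype) : ℤ) -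
        Module.finrank 𝕜 ↥((LinearMap.ker S.toFun).map S.domain.subtype ⊓
          (LinearMap.ker T†.toFun).map T†.domain.subtype) +
        Module.finrank 𝕜 ((LinearMap.ker S†.toFun).map S†.domain.subtype) := by
  rw [pmapKer_rolledUp_adjoint_eq_harmonic hdT hdS hcS hdomD hvalD, finrank_pmapKer_rolledUp hdS hST hdomD hvalD,
    Nat.cast_add]
  ring

/-! ### §2 `Δ_ev = D*D = T*T ⊕ SS*` on `E ⊕ G` -/

omit [CompleteSpace G] in
/-- `S*z ∈ D(T*)` for `z ∈ D(S*)` in a complex (`Im S* ⊆ Ker T* ⊆ D(T*)`). [cite: BruningLesch1992, §2 (2.6), (2.8b)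
(the dual complex); DemaillyAGBook, Ch. VIII §1 Thm 1.2 (proof, "considering the dual pair `(S*, T*)`")] -/
theorem adjoint_apply_mem_adjoint_domain (hdS : Dense (S.domain : Set F))
    (hST : LinearMap.range T.toFun ≤ (LinearMap.ker S.toFun).map S.domain.subtype) (z : S†.domain) :
    (S† z : F) ∈ T†.domain :=
  (mem_pmapKer_iff.1 (range_adjoint_le_pmapKer_adjoint hdS hST (LinearMap.mem_range_self _ z))).1

omit [CompleteSpace G] in
/-- `T*(S*z) = 0` for `z ∈ D(S*)` (`(ST)* = T*S* = 0`). [cite: BruningLesch1992, §2 (2.6), (2.8b); DemaillyAGBook,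
Ch. VIII §1 Thm 1.2 (proof)] -/
theorem adjoint_apply_adjoint_apply_eq_zero (hdS : Dense (S.domain : Set F))
    (hST : LinearMap.range T.toFun ≤ (LinearMap.ker S.toFun).map S.domain.subtype) (z : S†.domain) :
    T† ⟨S† z, adjoint_apply_mem_adjoint_domain hdS hST z⟩ = 0 :=
  (mem_pmapKer_iff.1 (range_adjoint_le_pmapKer_adjoint hdS hST (LinearMap.mem_range_self _ z))).2

omit [CompleteSpace E] [CompleteSpace F] [CompleteSpace G] in
/-- `Tx ∈ D(S)` and `S(Tx) = 0` for `x ∈ D(T)` (`Im T ⊆ Ker S`). [cite: BruningLesch1992, §2 (2.1)–(2.2)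
("`𝒟_i ⊂ 𝒟_{i+1}` … `D_{i+1}D_i = 0`")] -/
theorem apply_mem_domain_and_apply_apply_eq_zero
    (hST : LinearMap.range T.toFun ≤ (LinearMap.ker S.toFun).map S.domain.subtype) (x : T.domain) :
    ∃ h : (T x : F) ∈ S.domain, S ⟨T x, h⟩ = 0 :=
  mem_pmapKer_iff.1 (hST (LinearMap.mem_range_self _ x))

/-- **`D(D*D) = D(T*T) × D(SS*)`**: for `v = x ⊕ z ∈ D(D)`, `Dv ∈ D(D*) ⇔ x ∈ D(T*T) ∧ z ∈ D(SS*)` — since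
`Dv = Tx + S*z` with `S*z ∈ Ker T* ⊆ D(T*)` and `Tx ∈ Ker S ⊆ D(S)` always. [cite: BruningLesch1992, §2 (2.14a)–(2.14b)
("`Δ_ev := D*D`", "`Δ = ⊕ D_{i−1}D*_{i−1} ⊕ D_i*D_i`"); Gilkey1995, §1.5 p. 45 ("`(d + δ)_e^*(d + δ)_e = Δ`")] -/
theorem rolledUp_apply_mem_adjoint_domain_iff (hdT : Dense (T.domain : Set E)) (hdS : Dense (S.domain : Set F))
    (hcS : S.IsClosed) (hST : LinearMap.range T.toFun ≤ (LinearMap.ker S.toFun).map S.domain.subtype)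
    (hdomD : ∀ v : WithLp 2 (E × G), v ∈ D.domain ↔ v.fst ∈ T.domain ∧ v.snd ∈ S†.domain)
    (hvalD : ∀ (v : D.domain) (h1 : (v : WithLp 2 (E × G)).fst ∈ T.domain)
      (h2 : (v : WithLp 2 (E × G)).snd ∈ S†.domain),
      D v = T ⟨(v : WithLp 2 (E × G)).fst, h1⟩ + S† ⟨(v : WithLp 2 (E × G)).snd, h2⟩)
    (hdomA : ∀ x : E, x ∈ A.domain ↔ ∃ hx : x ∈ T.domain, T ⟨x, hx⟩ ∈ T†.domain)
    (hdomC : ∀ y : G, y ∈ C.domain ↔ ∃ hy : y ∈ S†.domain, S† ⟨y, hy⟩ ∈ S.domain) (v : D.domain) :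
    D v ∈ D†.domain ↔ (v : WithLp 2 (E × G)).fst ∈ A.domain ∧ (v : WithLp 2 (E × G)).snd ∈ C.domain := by
  have h1 := ((hdomD _).1 v.2).1
  have h2 := ((hdomD _).1 v.2).2
  obtain ⟨hTxS, hSTx⟩ := apply_mem_domain_and_apply_apply_eq_zero hST ⟨_, h1⟩
  have hSzT := adjoint_apply_mem_adjoint_domain hdS hST ⟨_, h2⟩
  rw [mem_rolledUp_adjoint_domain_iff hdT hdS hcS hdomD hvalD, hvalD v h1 h2, hdomA, hdomC]
  constructor
  · rintro ⟨hT, hS⟩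
    refine ⟨⟨h1, ?_⟩, ⟨h2, ?_⟩⟩
    · have h := T†.domain.sub_mem hT hSzT
      rwa [add_sub_cancel_right] at h
    · have h := S.domain.sub_mem hS hTxS
      rwa [add_sub_cancel_left] at h
  · rintro ⟨⟨h1', hTx⟩, ⟨h2', hSz⟩⟩
    exact ⟨T†.domain.add_mem hTx hSzT, S.domain.add_mem hTxS hSz⟩

/-- **`D*D(x ⊕ z) = T*Tx ⊕ SS*z`**: `D*(Tx + S*z) = (T*Tx + T*S*z) ⊕ (STx + SS*z) = T*Tx ⊕ SS*z` (`T*S* = 0`,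
`ST = 0`) — "`Δ_ev = D*D`" agrees with the Laplacians `T*T` on `E` and `SS*` on `G`. [cite: BruningLesch1992, §2
(2.14a)–(2.14b); Gilkey1995, §1.5 p. 45 ("`(d + δ)_e^*(d + δ)_e = Δ`")] -/
theorem rolledUp_adjoint_rolledUp_apply (hdT : Dense (T.domain : Set E)) (hdS : Dense (S.domain : Set F))
    (hcS : S.IsClosed) (hST : LinearMap.range T.toFun ≤ (LinearMap.ker S.toFun).map S.domain.subtype)
    (hdomD : ∀ v : WithLp 2 (E × G), v ∈ D.domain ↔ v.fst ∈ T.domain ∧ v.snd ∈ S†.domain)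
    (hvalD : ∀ (v : D.domain) (h1 : (v : WithLp 2 (E × G)).fst ∈ T.domain)
      (h2 : (v : WithLp 2 (E × G)).snd ∈ S†.domain),
      D v = T ⟨(v : WithLp 2 (E × G)).fst, h1⟩ + S† ⟨(v : WithLp 2 (E × G)).snd, h2⟩)
    (hdomA : ∀ x : E, x ∈ A.domain ↔ ∃ hx : x ∈ T.domain, T ⟨x, hx⟩ ∈ T†.domain)
    (hvalA : ∀ (x : A.domain) (hx : (x : E) ∈ T.domain) (hTx : T ⟨x, hx⟩ ∈ T†.domain),
      A x = T† ⟨T ⟨x, hx⟩, hTx⟩)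
    (hdomC : ∀ y : G, y ∈ C.domain ↔ ∃ hy : y ∈ S†.domain, S† ⟨y, hy⟩ ∈ S.domain)
    (hvalC : ∀ (y : C.domain) (hy : (y : G) ∈ S†.domain) (hSy : S† ⟨y, hy⟩ ∈ S.domain),
      C y = S ⟨S† ⟨y, hy⟩, hSy⟩)
    (v : D.domain) (hDv : D v ∈ D†.domain) (hA : (v : WithLp 2 (E × G)).fst ∈ A.domain)
    (hC : (v : WithLp 2 (E × G)).snd ∈ C.domain) :
    D† ⟨D v, hDv⟩ = WithLp.toLp 2 ((A ⟨_, hA⟩ : E), (C ⟨_, hC⟩ : G)) := by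
  have h1 := ((hdomD _).1 v.2).1
  have h2 := ((hdomD _).1 v.2).2
  obtain ⟨hTxS, hSTx⟩ := apply_mem_domain_and_apply_apply_eq_zero hST ⟨_, h1⟩
  have hSzT := adjoint_apply_mem_adjoint_domain hdS hST ⟨_, h2⟩
  have hTSz := adjoint_apply_adjoint_apply_eq_zero hdS hST ⟨_, h2⟩
  obtain ⟨hDT, hDS⟩ := (mem_rolledUp_adjoint_domain_iff hdT hdS hcS hdomD hvalD _).1 hDv
  obtain ⟨hxT, hTx⟩ := (hdomA _).1 hA
  obtain ⟨hzS, hSz⟩ := (hdomC _).1 hC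
  rw [rolledUp_adjoint_apply hdT hdS hcS hdomD hvalD ⟨D v, hDv⟩ hDT hDS, hvalA ⟨_, hA⟩ hxT hTx,
    hvalC ⟨_, hC⟩ hzS hSz]
  have eT : (⟨D v, hDT⟩ : T†.domain) = ⟨T ⟨_, h1⟩, hTx⟩ + ⟨S† ⟨_, h2⟩, hSzT⟩ :=
    Subtype.ext (hvalD v h1 h2)
  have eS : (⟨D v, hDS⟩ : S.domain) = ⟨T ⟨_, h1⟩, hTxS⟩ + ⟨S† ⟨_, h2⟩, hSz⟩ :=
    Subtype.ext (hvalD v h1 h2)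
  rw [eT, eS, LinearPMap.map_add, LinearPMap.map_add, hTSz, add_zero, hSTx, zero_add]

/-! ### §3 `Δ_odd = DD* = TT* + S*S` on `F` -/

/-- **`D(DD*) = D(□)`**: `u ∈ D(D*)` with `D*u = T*u ⊕ Su ∈ D(D) = D(T) × D(S*)` iff `u ∈ D(□) = {u ∈ D(T*) ∩ D(S) :
T*u ∈ D(T), Su ∈ D(S*)}`. [cite: BruningLesch1992, §2 (2.14a)–(2.14b) ("`Δ_odd := DD*`", "`Δ = ⊕ D_{i−1}D*_{i−1} ⊕
D_i*D_i`"); Gilkey1995, §1.5 p. 45] -/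
theorem rolledUp_adjoint_apply_mem_domain_iff (hdT : Dense (T.domain : Set E)) (hdS : Dense (S.domain : Set F))
    (hcS : S.IsClosed)
    (hdomD : ∀ v : WithLp 2 (E × G), v ∈ D.domain ↔ v.fst ∈ T.domain ∧ v.snd ∈ S†.domain)
    (hvalD : ∀ (v : D.domain) (h1 : (v : WithLp 2 (E × G)).fst ∈ T.domain)
      (h2 : (v : WithLp 2 (E × G)).snd ∈ S†.domain),
      D v = T ⟨(v : WithLp 2 (E × G)).fst, h1⟩ + S† ⟨(v : WithLp 2 (E × G)).snd, h2⟩)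
    (hdom : ∀ x : F, x ∈ L.domain ↔ (∃ hxT : x ∈ T†.domain, T† ⟨x, hxT⟩ ∈ T.domain) ∧
      (∃ hxS : x ∈ S.domain, S ⟨x, hxS⟩ ∈ S†.domain)) (u : F) :
    (∃ hu : u ∈ D†.domain, D† ⟨u, hu⟩ ∈ D.domain) ↔ u ∈ L.domain := by
  rw [hdom]
  constructor
  · rintro ⟨hu, hDu⟩
    obtain ⟨huT, huS⟩ := (mem_rolledUp_adjoint_domain_iff hdT hdS hcS hdomD hvalD u).1 hu
    rw [rolledUp_adjoint_apply hdT hdS hcS hdomD hvalD ⟨u, hu⟩ huT huS, hdomD] at hDu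
    exact ⟨⟨huT, hDu.1⟩, ⟨huS, hDu.2⟩⟩
  · rintro ⟨⟨huT, hTu⟩, ⟨huS, hSu⟩⟩
    have hu : u ∈ D†.domain := (mem_rolledUp_adjoint_domain_iff hdT hdS hcS hdomD hvalD u).2 ⟨huT, huS⟩
    refine ⟨hu, ?_⟩
    rw [rolledUp_adjoint_apply hdT hdS hcS hdomD hvalD ⟨u, hu⟩ huT huS, hdomD]
    exact ⟨hTu, hSu⟩

/-- **`DD*u = TT*u + S*Su = □u`** — "`Δ_odd = DD*`" is the middle Laplacian. [cite: BruningLesch1992, §2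
(2.14a)–(2.14b); Gilkey1995, §1.5 p. 45 and §1.6 ("`Δ_p = (dδ + δd)_p`")] -/
theorem rolledUp_rolledUp_adjoint_apply (hdT : Dense (T.domain : Set E)) (hdS : Dense (S.domain : Set F))
    (hcS : S.IsClosed)
    (hdomD : ∀ v : WithLp 2 (E × G), v ∈ D.domain ↔ v.fst ∈ T.domain ∧ v.snd ∈ S†.domain)
    (hvalD : ∀ (v : D.domain) (h1 : (v : WithLp 2 (E × G)).fst ∈ T.domain)
      (h2 : (v : WithLp 2 (E × G)).snd ∈ S†.domain),
      D v = T ⟨(v : WithLp 2 (E × G)).fst, h1⟩ + S† ⟨(v : WithLp 2 (E × G)).snd, h2⟩)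
    (hdom : ∀ x : F, x ∈ L.domain ↔ (∃ hxT : x ∈ T†.domain, T† ⟨x, hxT⟩ ∈ T.domain) ∧
      (∃ hxS : x ∈ S.domain, S ⟨x, hxS⟩ ∈ S†.domain))
    (hval : ∀ (x : L.domain) (hxT : (x : F) ∈ T†.domain) (hTx : T† ⟨x, hxT⟩ ∈ T.domain)
      (hxS : (x : F) ∈ S.domain) (hSx : S ⟨x, hxS⟩ ∈ S†.domain),
      L x = T ⟨T† ⟨x, hxT⟩, hTx⟩ + S† ⟨S ⟨x, hxS⟩, hSx⟩)
    (u : L.domain) (hu : (u : F) ∈ D†.domain) (hDu : D† ⟨u, hu⟩ ∈ D.domain) :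
    D ⟨D† ⟨u, hu⟩, hDu⟩ = L u := by
  obtain ⟨⟨huT, hTu⟩, ⟨huS, hSu⟩⟩ := (hdom u).1 u.2
  have e : (⟨D† ⟨u, hu⟩, hDu⟩ : D.domain) =
      ⟨WithLp.toLp 2 ((T† ⟨u, huT⟩ : E), (S ⟨u, huS⟩ : G)), (hdomD _).2 ⟨hTu, hSu⟩⟩ :=
    Subtype.ext (rolledUp_adjoint_apply hdT hdS hcS hdomD hvalD ⟨u, hu⟩ huT huS)
  rw [e, rolledUp_apply hdomD hvalD ⟨_, hTu⟩ ⟨_, hSu⟩, hval u huT hTu huS hSu]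

/-- **`(D*Du, u)`-type identity `‖Dv‖² = (Av₁, v₁) + (Cv₂, v₂)`** is immediate from §2; here the companion for `□`:
`‖D*u‖² = Re(□u, u)` for `u ∈ D(□)` (`= ‖T*u‖² + ‖Su‖²`). [cite: BruningLesch1992, §2 (2.13)–(2.14a); Gilkey1995,
§1.5 p. 45] -/
theorem norm_sq_rolledUp_adjoint_apply_eq_re_inner_laplacian (hdT : Dense (T.domain : Set E))
    (hdS : Dense (S.domain : Set F)) (hcS : S.IsClosed)
    (hdomD : ∀ v : WithLp 2 (E × G), v ∈ D.domain ↔ v.fst ∈ T.domain ∧ v.snd ∈ S†.domain)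
    (hvalD : ∀ (v : D.domain) (h1 : (v : WithLp 2 (E × G)).fst ∈ T.domain)
      (h2 : (v : WithLp 2 (E × G)).snd ∈ S†.domain),
      D v = T ⟨(v : WithLp 2 (E × G)).fst, h1⟩ + S† ⟨(v : WithLp 2 (E × G)).snd, h2⟩)
    (hdom : ∀ x : F, x ∈ L.domain ↔ (∃ hxT : x ∈ T†.domain, T† ⟨x, hxT⟩ ∈ T.domain) ∧
      (∃ hxS : x ∈ S.domain, S ⟨x, hxS⟩ ∈ S†.domain))
    (hval : ∀ (x : L.domain) (hxT : (x : F) ∈ T†.domain) (hTx : T† ⟨x, hxT⟩ ∈ T.domain)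
      (hxS : (x : F) ∈ S.domain) (hSx : S ⟨x, hxS⟩ ∈ S†.domain),
      L x = T ⟨T† ⟨x, hxT⟩, hTx⟩ + S† ⟨S ⟨x, hxS⟩, hSx⟩)
    (u : L.domain) (hu : (u : F) ∈ D†.domain) :
    ‖D† ⟨u, hu⟩‖ ^ 2 = RCLike.re ⟪L u, (u : F)⟫_𝕜 := by
  obtain ⟨⟨huT, hTu⟩, ⟨huS, hSu⟩⟩ := (hdom u).1 u.2
  rw [norm_sq_rolledUp_adjoint_apply hdT hdS hcS hdomD hvalD ⟨u, hu⟩ huT huS,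
    re_inner_laplacian_self hdT hdS hdom hval u]

end Literature.Analysis.InnerProduct
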